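import Summits.PneNP.PneNP.Theses.RamseyUncertifiable
import Literature.Combinatorics.SimpleGraph.PaleySos
import Literature.Combinatorics.SimpleGraph.FKPseudomoments
import Summits.PneNP.PneNP.Theorems.RamseyUncertifiablePaleySosRungInducedMonotone
import Summits.PneNP.PneNP.Theorems.RamseyUncertifiablePaleySosRungFilledReduction
import Summits.PneNP.PneNP.Theorems.RamseyUncertifiablePaleySosRungPatternBias
import Summits.PneNP.PneNP.Theorems.RamseyUncertifiablePaleySosRungSmallBiasCodegrees
import Summits.PneNP.PneNP.Theorems.RamseyUncertifiablePaleySosRungCrossNorm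
import Summits.PneNP.PneNP.Theorems.RamseyUncertifiablePaleySosRungFilledShell

/-!
# Route `RamseyUncertifiable` — crux `PaleySosRung` (stmt-PneNP-9817): the proof

`∀ t ≥ 1, ∃ η > 0, ∃ p₀, ∀ primes p ≥ p₀ with p ≡ 1 (mod 4): p^η ≤ las⁽ᵗ⁾(P_p)` for the Paley
graph `P_p = SimpleGraph.fromRel fun x y : Fin p => IsSquare (x - y)` and Laurent's Lasserre
bound `las⁽ᵗ⁾ = lasserreStableBound`: NO CONSTANT LEVEL of the Lasserre / sum-of-squares hierarchy
certifies that the clique number of the Paley graph is `p^{o(1)}`.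

Line `weil-patch-transfer` of the crux (lead prover-line-stmt-PneNP-9817-0, 2026-08-16), composed
from its six landed stubs (all in `Summit.PneNP.PneNP.Theorems.PaleySosRungWeilPatch[Transfer]`):

* (I) `stub_inducedMonotone` — `las⁽ᵗ⁾(G.comap f) ≤ las⁽ᵗ⁾(G)` (zero extension);
* (N) `stub_paleyPatternBias` — Weil: the family of injective patches `Fin m ↪ Fin p` of `P_p` is
  `k`-wise `O_k(1/√p)`-biased;
* (P) `stub_smallBiasCodegrees` — a `k`-wise `m^{-k}`-biased family has concentrated star
  codegrees outside a third of its members (moment method, Füredi–Komlós count);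
* (D) `stub_crossNormOfCodegrees` — codegree concentration gives the rectangular MPW cross
  matrices `R_{a,b}` operator norm `≤ m^{(a+b)/2 − 1/8}` (Schur test + Newton bound);
* (S) `stub_filledShell` — those bounds make the Feige–Krauthgamer moments with levels
  `2^{C(k,2)} 8^{k²} α^k`, `α = m^{1/(16t) − 1}`, have a PSD level-`t` filled matrix
  (binomial-basis positivity of the constant part + block AM–GM for the pattern part);
* (F) `stub_filledReduction` — a PSD filled matrix gives a PSD Lasserre moment matrix.

The composition: patch size `m = ⌊p^{1/(2K+2)}⌋` (so that the Weil bias `C/√p` is below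
`m^{-K}`), a good patch outside the exceptional third, the shell on the complemented patch, FK
feasibility for the patch itself with value `m·α₁ ≥ m^η`, induced monotonicity back to `P_p`, and
`p^{η/(4K+4)} ≤ m^η`. Exponent: `η_t = (1/(16t)) / (4K+4)`, `K = K(t)` from (P).

References: Feige–Krauthgamer, SIAM J. Comput. 32 (2003); Meka–Potechin–Wigderson,
arXiv:1503.06447 (the cross matrices); Kunisky–Yu, arXiv:2211.02713 (FK moments for Paley at
level 2, the `t = 2` case); Weil 1948 / Schmidt 1976 (character sums, via the tree).
-/

set_option linter.dupNamespace false -- `Summit.PneNP.PneNP.…`: summit = sub-problem (D-0017)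

namespace Summit.PneNP.PneNP.Theorems.PaleySosRungWeilPatch

open Literature.Combinatorics.SimpleGraph Finset Matrix
open Summit.PneNP.PneNP.Theses.RamseyUncertifiable
open Summit.PneNP.PneNP.Theorems.PaleySosRungWeilPatchTransfer

noncomputable section

/-- **`PaleySosRung` from the six stubs.** Fix `t ≥ 1`; the shell (S) at level `t` yields an
exponent `η > 0` and a threshold; (D) and (P) at `r = t` yield a threshold, a pattern size `k` and
a threshold; put `K = k`, `L = 2K + 2` and let `C` be the Weil constant of (N) at `K`. For a prime
`p ≡ 1 (mod 4)`, `p ≥ p₀`, take the patch size `m = ⌊p^{1/L}⌋`, so that `C·m^K ≤ √p`, `m` exceeds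
every threshold, and `m ≥ p^{1/(2L)}`. The family of complemented patches `x ↦ (P_p.comap x)ᶜ`,
`x : Fin m ↪ Fin p`, is `K`-wise `m^{-K}`-biased by (N); by (P) at most a third of the samples
violate codegree concentration, so some patch `H` has it; (D) gives the cross-matrix bounds for `H`,
(S) gives levels `α` with a PSD filled matrix and `m^η ≤ m·α₁`, (F) makes the FK moments of `H`
Lasserre-feasible for `Hᶜ = P_p.comap x` with value `m·α₁`, and (I) transfers
`m^η ≤ las_t(P_p.comap x) ≤ las_t(P_p)`; finally `p^{η/(2L)} ≤ m^η`. -/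
theorem paleySosRung_proof : Summit.PneNP.PneNP.Theses.RamseyUncertifiable.PaleySosRung := by
  intro t ht
  -- (S), (D), (P), (N): the parameters of the line at level `t`
  obtain ⟨η, hη, n₀, hS⟩ := stub_filledShell t ht
  obtain ⟨m₁, hD⟩ := stub_crossNormOfCodegrees t
  obtain ⟨K, m₂, hP⟩ := stub_smallBiasCodegrees t
  obtain ⟨C, hC0, hN⟩ := stub_paleyPatternBias K
  set L : ℕ := 2 * K + 2 with hL
  set M₀ : ℕ := max 1 (max n₀ (max m₁ m₂)) with hM₀
  set p₀ : ℕ := max (⌈C⌉₊ ^ L) (max ((M₀ + 1) ^ L) (4 ^ L)) with hp₀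
  have hLne : L ≠ 0 := by omega
  refine ⟨(L : ℝ)⁻¹ * ((1 / 2 : ℝ) * η), by positivity, p₀, fun p hp hprime h4 => ?_⟩
  -- basic facts about `p`
  have hp1 : (1 : ℝ) ≤ p := by exact_mod_cast hprime.one_lt.le
  have hp0 : (0 : ℝ) ≤ p := by positivity
  -- `ρ = p^{1/L}` and the patch size `m = ⌊ρ⌋`
  set ρ : ℝ := (p : ℝ) ^ ((L : ℝ)⁻¹) with hρ
  have hρ0 : 0 ≤ ρ := Real.rpow_nonneg hp0 _
  have hρL : ρ ^ L = (p : ℝ) := Real.rpow_inv_natCast_pow hp0 hLne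
  set m : ℕ := ⌊ρ⌋₊ with hm
  have hmρ : (m : ℝ) ≤ ρ := Nat.floor_le hρ0
  have hρm : ρ < m + 1 := Nat.lt_floor_add_one ρ
  -- `L`-th roots of the three lower bounds on `p`
  have root_le : ∀ x : ℝ, 0 ≤ x → x ^ L ≤ (p : ℝ) → x ≤ ρ := by
    intro x hx hxL
    rw [← hρL] at hxL
    exact (pow_le_pow_iff_left₀ hx hρ0 hLne).1 hxL
  have hCρ : C ≤ ρ := by
    refine (Nat.le_ceil C).trans (root_le _ (by positivity) ?_)
    exact_mod_cast (le_max_left _ _).trans hp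
  have hMρ : (M₀ : ℝ) + 1 ≤ ρ := by
    have h := root_le ((M₀ : ℝ) + 1) (by positivity)
      (by exact_mod_cast ((le_max_left _ _).trans (le_max_right _ _)).trans hp)
    exact h
  have h4ρ : (4 : ℝ) ≤ ρ :=
    root_le 4 (by norm_num) (by exact_mod_cast ((le_max_right _ _).trans (le_max_right _ _)).trans hp)
  -- `m` exceeds every threshold
  have hmM : M₀ ≤ m := by
    have h : (M₀ : ℝ) < (m : ℝ) + 1 := by linarith
    have h' : M₀ < m + 1 := by exact_mod_cast h
    omega
  have hm1 : 1 ≤ m := le_trans (le_max_left _ _) hmM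
  have hmn₀ : n₀ ≤ m := le_trans ((le_max_left _ _).trans (le_max_right _ _)) hmM
  have hmm₁ : m₁ ≤ m :=
    le_trans (((le_max_left _ _).trans (le_max_right _ _)).trans (le_max_right _ _)) hmM
  have hmm₂ : m₂ ≤ m :=
    le_trans (((le_max_right _ _).trans (le_max_right _ _)).trans (le_max_right _ _)) hmM
  have hm1R : (1 : ℝ) ≤ m := by exact_mod_cast hm1
  have hm0R : (0 : ℝ) < m := by linarith
  -- `m ≤ p`: the sample space `Fin m ↪ Fin p` is nonempty
  have hmp : m ≤ p := by
    have h : (m : ℝ) ≤ p := by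
      refine hmρ.trans ?_
      calc ρ = (p : ℝ) ^ ((L : ℝ)⁻¹) := rfl
        _ ≤ (p : ℝ) ^ (1 : ℝ) := by
            refine Real.rpow_le_rpow_of_exponent_le hp1 ?_
            exact inv_le_one_of_one_le₀ (by exact_mod_cast Nat.one_le_iff_ne_zero.2 hLne)
        _ = p := Real.rpow_one _
    exact_mod_cast h
  -- `C · m^K ≤ √p`: the Weil biases are below the small-bias threshold
  have hsqrt : Real.sqrt p = ρ ^ (K + 1) := by
    have hsq : ρ ^ (K + 1) * ρ ^ (K + 1) = (p : ℝ) := by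
      rw [← pow_add, show K + 1 + (K + 1) = L by omega, hρL]
    rw [← hsq, Real.sqrt_mul_self (pow_nonneg hρ0 _)]
  have hCm : C * (m : ℝ) ^ K ≤ Real.sqrt p := by
    rw [hsqrt, pow_succ']
    exact mul_le_mul hCρ (pow_le_pow_left₀ (Nat.cast_nonneg m) hmρ K) (by positivity) hρ0
  -- `p^{η/(2L)} ≤ m^η`
  have hfinal : (p : ℝ) ^ ((L : ℝ)⁻¹ * ((1 / 2 : ℝ) * η)) ≤ (m : ℝ) ^ η := by
    rw [Real.rpow_mul hp0, Real.rpow_mul hρ0, ← Real.sqrt_eq_rpow]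
    refine Real.rpow_le_rpow (Real.sqrt_nonneg _) ?_ hη.le
    -- `√ρ ≤ m` from `ρ < m + 1`, `ρ ≥ 4`
    have h2 : (2 : ℝ) ≤ Real.sqrt ρ := by
      rw [show (2 : ℝ) = Real.sqrt 4 by
        rw [show (4 : ℝ) = 2 ^ 2 by norm_num, Real.sqrt_sq (by norm_num)]]
      exact Real.sqrt_le_sqrt h4ρ
    have hsq : Real.sqrt ρ * Real.sqrt ρ = ρ := Real.mul_self_sqrt hρ0
    nlinarith
  -- the Paley graph, the sample space and the family of complemented patches
  set G₀ : SimpleGraph (Fin p) := paleyGraph p with hG₀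
  haveI instG : DecidableRel G₀.Adj := Classical.decRel _
  haveI : DecidableEq (Fin m ↪ Fin p) := Classical.decEq _
  have hcard : 0 < Fintype.card (Fin m ↪ Fin p) := by
    rw [Fintype.card_pos_iff]
    exact Function.Embedding.nonempty_of_card_le (by simpa using hmp)
  set H : (Fin m ↪ Fin p) → SimpleGraph (Fin m) := fun x => (G₀.comap x)ᶜ with hH
  -- (N) ⇒ the family is `K`-wise `m^{-K}`-biased (signs of `H x` are minus those of `G₀`)
  have hbias : ∀ E : Finset (Fin m × Fin m), E.Nonempty → E.card ≤ K →
      (∀ e ∈ E, e.1 < e.2) →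
      |∑ x : (Fin m ↪ Fin p), ∏ e ∈ E, (if (H x).Adj e.1 e.2 then (1 : ℝ) else -1)|
        ≤ (Fintype.card (Fin m ↪ Fin p) : ℝ) / (m : ℝ) ^ K := by
    intro E hE hEk hEo
    have hflip : ∀ x : (Fin m ↪ Fin p), ∏ e ∈ E, (if (H x).Adj e.1 e.2 then (1 : ℝ) else -1)
        = (-1) ^ E.card * ∏ e ∈ E, (if G₀.Adj (x e.1) (x e.2) then (1 : ℝ) else -1) := by
      intro x
      rw [← Finset.prod_neg]
      refine Finset.prod_congr rfl fun e he => ?_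
      have hne : e.1 ≠ e.2 := (hEo e he).ne
      have hadj : (H x).Adj e.1 e.2 ↔ ¬ G₀.Adj (x e.1) (x e.2) := by
        simp only [hH, SimpleGraph.compl_adj, SimpleGraph.comap_adj]
        exact ⟨fun h => h.2, fun h => ⟨hne, h⟩⟩
      by_cases h : G₀.Adj (x e.1) (x e.2)
      · rw [if_neg (fun h' => hadj.1 h' h), if_pos h]
      · rw [if_pos (hadj.2 h), if_neg h, neg_neg]
    rw [Finset.sum_congr rfl fun x _ => hflip x, ← Finset.mul_sum, abs_mul, abs_pow, abs_neg,
      abs_one, one_pow, one_mul]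
    have hW := hN p hprime h4 m E hE hEk hEo
    refine hW.trans ?_
    have hstep : C / Real.sqrt p ≤ 1 / (m : ℝ) ^ K := by
      rw [div_le_div_iff₀ (by positivity) (by positivity), one_mul]
      exact hCm
    calc C / Real.sqrt p * (Fintype.card (Fin m ↪ Fin p) : ℝ)
        ≤ 1 / (m : ℝ) ^ K * (Fintype.card (Fin m ↪ Fin p) : ℝ) :=
          mul_le_mul_of_nonneg_right hstep (Nat.cast_nonneg _)
      _ = (Fintype.card (Fin m ↪ Fin p) : ℝ) / (m : ℝ) ^ K := by
          rw [one_div, inv_mul_eq_div]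
  -- (P): all but at most a third of the samples have concentrated star codegrees
  obtain ⟨B, hB, hPB⟩ := hP m hmm₂ (Fin m ↪ Fin p) H hbias
  -- a good sample
  have hlt : B.card < (Finset.univ : Finset (Fin m ↪ Fin p)).card := by
    rw [Finset.card_univ]
    omega
  obtain ⟨x, -, hx⟩ := Finset.exists_mem_notMem_of_card_lt_card hlt
  -- (D): cross-matrix bounds for the good complemented patch; (S): the levels; (F): feasibility
  have hcross := hD m hmm₁ (H x) (hPB x hx)
  obtain ⟨α, hα0, hval, hpsd⟩ := hS m hmn₀ (H x) hcross
  have hM : (momentMatrix t (fkMoments (H x) α)).PosSemidef :=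
    stub_filledReduction m t (H x) α hα0 hpsd
  have hfeas : IsLasserreFeasible (H x)ᶜ t (fkMoments (H x) α) := by
    refine ⟨?_, ?_, hM⟩
    · rw [fkMoments_empty, hα0]
    · intro u v huv
      rw [SimpleGraph.compl_adj] at huv
      exact fkMoments_pair_of_not_adj _ α huv.1 huv.2
  have hlas := hfeas.sum_singleton_le_lasserreStableBound ht
  rw [sum_fkMoments_singleton, Fintype.card_fin] at hlas
  have hHc : (H x)ᶜ = G₀.comap x := compl_compl _
  rw [hHc] at hlas
  have hI := stub_inducedMonotone G₀ x ht
  rw [← paleyGraph_eq_fromRel]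
  exact hfinal.trans (hval.trans (hlas.trans hI))

end

end Summit.PneNP.PneNP.Theorems.PaleySosRungWeilPatch
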